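import Summits.HodgeConjecture.HodgeConjecture.Theorems.F0P3SqIntNotSphericalOfHeckeNeighbours   -- ★ (B-p08 (g23), L5-CM): `not_isSpherical_of_isSquareIntegrable_of_heckeNeighbours`
import Literature.NumberTheory.Automorphic.HyperspecialUnitaryRankOneNotSquareIntegrable        -- ★ (A-p03 (g22), L1b): `UnramifiedLocalConjDatum.exists_contractingTransversal_unitary_three`
import Literature.NumberTheory.Automorphic.HyperspecialUnitaryCartanAdicCompletion               -- ★ `unramifiedLocalConjDatum_adicCompletion` (the datum of `L_w ∕ L⁺_v` at an unramified inert `v`)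
import Literature.NumberTheory.Automorphic.AdicCompletionCompact                                -- ★ `finite_residueField_adicCompletion`
import Literature.NumberTheory.GaloisRepresentations.FrobeniusDensityTheorem                   -- ★ `GaloisRepresentations.finite_setOf_not_isUnramifiedIn` (only finitely many `v` ramify)
import Literature.NumberTheory.Rogawski1990.SquareIntegrableNotSphericalCofinite                  -- ★ letter #90 (SqNS) — for the docstring cross-reference only (its body is the target shape)
import HarnessLib

/-!
# `F0P3SqIntNotSphericalNonsplitCofinite` — road (B) CLOSED at the non-split places: for all but finitely many finite places `v` of `L⁺`
# that do not split in `L`, NO square-integrable class of `U(Φ₃)(L⁺_v)` is `U(Φ₃)(𝒪_v)`-spherical — HYPOTHESIS-FREE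

Cell `hodgecm-mathlib`, F0∕P3 «U3-mult», crux H413 (`stmt-HodgeConjecture-24833`), floor 0; fan-B rows #90 (SqNS)
`Rogawski1990.SquareIntegrableNotSphericalCofinite` and #79 (XP) `Rogawski1990.XiPinSphericalCofinite` (★ `F0P3XiPinSphericalOfSqIntNotSpherical`:
XP ⟸ SqNS, and every consumer of SqNS uses it under the non-split guard — F0P3-plan (g7) 19:48:39Z (3): SqNS♭).  Seat B-p08 (g23) (road (B)
author lineage g19∕g20; legs (L5-gen) ★ p832978, (L5-CM)), over A-p03 (g22)'s (L2-gen) ★ p832624, (L1) ★ p833008, (L1b).  PROOF LANE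
(`--supports stmt-HodgeConjecture-24833 --as helper`): theorems only; no `def`, no instance, no notation, no named fact, no `sorry`.

THE STATEMENT `squareIntegrableNotSpherical_nonsplit_cofinite L` IS THE BODY OF SqNS♭ — the letter #90 re-typed to the places where it is consumed
(F0P3-plan (g7) 2026-08-31T19:48:39Z (3), «weaker-or-equal; the `GL₃` split clause nobody consumes goes»):
`∀ᶠ v in cofinite, (∀ w ∣ v, c̄ • w = w) → ∀ μZ (c : IrrClass (Gqs L v)), c.IsSquareIntegrable μZ → ¬ c.IsSpherical (cmLocalIntegralLevel L 3 Φ₃ v)`.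
The cofinite set is «`v` unramified in `L`» (★ `GaloisRepresentations.finite_setOf_not_isUnramifiedIn`); at such a non-split `v` the one-place model
`U(σ_w, Φ₃)(L_w)` carries the unramified local conjugation datum (★ `unramifiedLocalConjDatum_adicCompletion`, dyadic places included), hence the
hyperspecial Hecke-neighbour data (★ (L1b) `exists_contractingTransversal_unitary_three`: `K_N = N(𝒪_w)`, `t = diag(ϖ,1,ϖ⁻¹)`, a contracting transversal
of `K₀tK₀∕K₀` of type `(q_v⁴, q_v − 1, 1)`), and ★ (L5-CM) `not_isSpherical_of_isSquareIntegrable_of_heckeNeighbours` transports the contracting-transversal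
criterion ★ (L2-gen) to `U(Φ₃)(L⁺_v)` with its level `U(Φ₃)(𝒪_v)`.

* `squareIntegrableNotSpherical_nonsplit_of_isUnramifiedIn` — pointwise, at every non-split `v` unramified in `L`;
* `squareIntegrableNotSpherical_nonsplit_cofinite` — the SqNS♭ body, `∀ᶠ v in cofinite`.

Print: [Macdonald1971, Ch. V §3] (spherical functions via the building; the spherical Plancherel measure has no atoms); [Rogawski1990, §12.2 p. 174 l. 1]
(«`π²(ξ)` is square-integrable … `πⁿ(ξ)` is unramified if `ξ` is»); [Casselman1980, §4]; [BruhatTits1972, (4.4.4)]; [SerreTrees1980, II.1.1].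
HONEST LABEL: HC_CM is proved only modulo the printed citations (2 named inputs hLiu418, h413 remain; behind them the booked printed statements) until
rung 0 closes; this file makes #90's consumed (non-split) content a theorem — the books move only when the desk re-types #90 to SqNS♭ (F0P3-plan (g7)).
-/

set_option autoImplicit false
set_option linter.dupNamespace false

noncomputable section

open MeasureTheory NumberField IsDedekindDomain Filter
open Literature.NumberTheory.Automorphic Literature.NumberTheory.Automorphic.UnitaryGroup Literature.NumberTheory.Automorphic.HermitianLattice
open Literature.NumberTheory.Rogawski1990

namespace Summit.HodgeConjecture.HodgeConjecture.Cruxes.H413.F0P3SqIntNotSphericalNonsplitCofinite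

variable (L : Type) [Field L] [NumberField L] [IsCMField L]

/-- **SQUARE-INTEGRABLE ⇒ NOT `U(Φ₃)(𝒪_v)`-SPHERICAL at every non-split place `v` of `L⁺` that is UNRAMIFIED in `L`** (hypothesis-free; dyadic places
included): the one-place model at `w ∣ v` carries ★ `unramifiedLocalConjDatum_adicCompletion`, its residue field is finite (★ `finite_residueField_adicCompletion`),
`σ_w ≠ id` (complex conjugation moves some `e ∈ L ⊆ L_w`), so ★ (L1b) `exists_contractingTransversal_unitary_three` supplies the data of ★ (L5-CM)
`not_isSpherical_of_isSquareIntegrable_of_heckeNeighbours`. [cite: Macdonald1971, Ch. V §3] [cite: Rogawski1990, §12.2 p. 174] [cite: BruhatTits1972, (4.4.4)] -/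
theorem squareIntegrableNotSpherical_nonsplit_of_isUnramifiedIn (v : HeightOneSpectrum (𝓞 ↥(maximalRealSubfield L)))
    (hns : ∀ w : PlacesOver L v, IsCMField.complexConj L • w.1 = w.1) (hunr : Algebra.IsUnramifiedIn (𝓞 L) v.asIdeal)
    [MeasurableSpace (Gqs L v ⧸ Subgroup.center (Gqs L v))] [BorelSpace (Gqs L v ⧸ Subgroup.center (Gqs L v))]
    (μZ : Measure (Gqs L v ⧸ Subgroup.center (Gqs L v))) [μZ.IsHaarMeasure]
    (c : IrrClass (Gqs L v)) (hsq : c.IsSquareIntegrable μZ) :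
    ¬ c.IsSpherical (cmLocalIntegralLevel L 3 (qsForm L) v) := by
  classical
  obtain ⟨w⟩ := (inferInstance : Nonempty (PlacesOver L v))
  haveI := finite_residueField_adicCompletion L w.1
  obtain ⟨ϖ, hd⟩ := unramifiedLocalConjDatum_adicCompletion (IsCMField.complexConj L) (IsCMField.complexConj_ne_one L) v w (hns w) hunr
  -- `σ_w ≠ id`: complex conjugation moves some `e ∈ L`, and `L → L_w` is injective
  have hσ : ∃ x : w.1.adicCompletion L, galAdicCompletionMap (L := L) (IsCMField.complexConj L) (hns w) x ≠ x := by
    obtain ⟨y, hy⟩ : ∃ y : L, IsCMField.complexConj L y ≠ y :=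
      not_forall.1 fun h => IsCMField.complexConj_ne_one L (AlgEquiv.ext h)
    refine ⟨((y : L) : w.1.adicCompletion L), fun h => hy ?_⟩
    rw [galAdicCompletionMap_coe_algEquiv] at h
    exact (algebraMap L (w.1.adicCompletion L)).injective h
  obtain ⟨KN, a, b, t, Xp, X0, hba, hab, hKN, ht, hsymm, hD, hXp, hX0, hX, hcp, hc0⟩ :=
    hd.exists_contractingTransversal_unitary_three hσ
  exact F0P3SqIntNotSphericalOfHeckeNeighbours.not_isSpherical_of_isSquareIntegrable_of_heckeNeighbours L v hns w hba hab hKN ht hsymm hD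
    hXp hX0 hX hcp hc0 μZ c hsq

/-- **SqNS♭ — THE NON-SPLIT CONTENT OF LETTER #90 `Rogawski1990.SquareIntegrableNotSphericalCofinite`, HYPOTHESIS-FREE**: for all but finitely many finite
places `v` of `L⁺` (namely the `v` unramified in `L`, ★ `GaloisRepresentations.finite_setOf_not_isUnramifiedIn`), IF `v` does not split in `L` then for every
Haar measure `μZ` on `U(Φ₃)(L⁺_v) ⧸ Z` and every class `c ∈ Irr(U(Φ₃)(L⁺_v))`, `c.IsSquareIntegrable μZ → ¬ c.IsSpherical (cmLocalIntegralLevel L 3 Φ₃ v)`.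
Body = ★ `SquareIntegrableNotSphericalCofinite L`'s body under the non-split guard `∀ w : PlacesOver L v, c̄ • w.1 = w.1`, token for token.
[cite: Macdonald1971, Ch. V §3] [cite: Rogawski1990, §12.2 p. 174] [cite: Casselman1980, §4] [cite: BruhatTits1972, (4.4.4)] [cite: SerreTrees1980, II.1.1] -/
theorem squareIntegrableNotSpherical_nonsplit_cofinite :
    ∀ᶠ v : HeightOneSpectrum (𝓞 ↥(maximalRealSubfield L)) in cofinite,
      (∀ w : PlacesOver L v, IsCMField.complexConj L • w.1 = w.1) →
      ∀ [MeasurableSpace (Gqs L v ⧸ Subgroup.center (Gqs L v))] [BorelSpace (Gqs L v ⧸ Subgroup.center (Gqs L v))]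
        (μZ : Measure (Gqs L v ⧸ Subgroup.center (Gqs L v))) [μZ.IsHaarMeasure] (c : IrrClass (Gqs L v)),
        c.IsSquareIntegrable μZ → ¬ c.IsSpherical (cmLocalIntegralLevel L 3 (qsForm L) v) := by
  filter_upwards [eventually_cofinite.2 (Literature.NumberTheory.GaloisRepresentations.finite_setOf_not_isUnramifiedIn (↥(maximalRealSubfield L)) L)]
    with v hunr hns _ _ μZ _ c hsq
  exact squareIntegrableNotSpherical_nonsplit_of_isUnramifiedIn L v hns hunr μZ c hsq

end Summit.HodgeConjecture.HodgeConjecture.Cruxes.H413.F0P3SqIntNotSphericalNonsplitCofinite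

end
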